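import Literature.Computability.AlgebraicComplexity.LaserFormatPooling
import Literature.Computability.AlgebraicComplexity.LaserFormatPoolingData
import HarnessLib

/-!
# Laser pieces: packaged pooling data for the laser method in format currency

`LaserFormatPooling.laserMethod_hasFormatValue_pair_of_mul` pools the laser data of TWO
partitioned tensors (the count exponent of `t ⊗ t'` is the minimum of the POOLED marginal
entropies, not the pool of the minima — Coppersmith 1997's mechanism of combining several
instances of the Coppersmith–Winograd construction, Le Gall 2012 §6 for the `𝒞`-tensor family of
`CW_q ⊗ CW_q`).  Its inputs are the raw laser data (tight support, block format values, rational
law of product form), its output a `HasFormatValue`; so to pool THREE or more letters (Le Gall's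
Table 2 uses the `[112] : [121] : [211]`-family in ratios other than `1 : 1 : 2`, e.g. for
`ω(1,1,k)`, `k ≥ 2`, where the optimal block is `[112]`/`[121]`-heavy) one must iterate at the
level of the DATA.  This file packages the data as a structure `LaserPiece K t bI bJ bL` and
proves that it is closed under pairing (`LaserPiece.pair`, the data of `t ⊗ t'` with pair labels:
pair support, concatenated tightness maps `appendRows`, Kronecker block values, product counts
and the product law, which is again of product form), with

* the reading `LaserPiece.hasFormatValue`:
  `HasFormatValue t (2^{min(H₁,H₂,H₃)} · Π_S v^P) (Π_S fA^P) (Π_S fB^P) (Π_S fC^P)`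
  (`laserMethod_hasFormatValue_of_counts` with `Γ_S(P) = 0` for a product-form law,
  `maxEntropyPenalty_eq_zero_of_mul`);
* additivity of the three marginal entropies and multiplicativity of the four weighted products
  under pairing (`LaserPiece.pair_H₁/₂/₃`, `pair_val`, `pair_fmtA/B/C`), so that the value of an
  `n`-fold pooled block is read off by `simp`.

No new mathematics: every field of `LaserPiece.pair` is one of the pair-data combinators of
`LaserFormatPooling` / `LaserFormatPoolingData` (Le Gall 2014 §5: "supp(t ⊗ t′) consists of the
pairs of support triples and the component of a pair is the Kronecker product of the components").

References: D. Coppersmith, *Rectangular matrix multiplication revisited*, J. Complexity 13 (1997),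
§3 [Coppersmith1997]; F. Le Gall, *Faster algorithms for rectangular matrix multiplication*,
FOCS 2012, arXiv:1204.1111, §6.1 and Prop. 6.2 [LeGall2012]; F. Le Gall, *Powers of tensors and
fast matrix multiplication*, ISSAC 2014, Thm 4.1 and §5 [LeGall2014].
-/

set_option autoImplicit false
set_option linter.style.longLine false
set_option linter.unusedSectionVars false
set_option linter.unusedVariables false

noncomputable section

open Finset Real
open scoped BigOperators

universe u

namespace Literature.Computability.AlgebraicComplexity

open Literature.Barriers.MatrixMultiplication

/-- **Laser data of a partitioned tensor, of product form** (the hypotheses of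
`laserMethod_hasFormatValue_of_counts` + a product-form factorisation of the law): a support
`S ⊇ supp_D t` of block labels, injective bounded tightness maps `α, β, γ : · → ℤ^r` with
`α i + β j + γ l = 0` on `S`, block format values `(v; fA, fB, fC) > 0` of the components `t(s)`,
`s ∈ S`, integer counts `c` of total `d > 0` with the law `P = c/d`, and positive factors with
`P(i,j,l) = f(i) g(j) h(l)` on `S` (so `Γ_S(P) = 0`). [cite: LeGall2014, Thm. 4.1 and §5]
[cite: Coppersmith1997, §3] [cite: LeGall2012, §3] -/
structure LaserPiece (K : Type u) [Field K] {ι κ μ : Type} [Fintype ι] [Fintype κ] [Fintype μ]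
    [DecidableEq ι] [DecidableEq κ] [DecidableEq μ] (t : ι → κ → μ → K) {I J L : Type} [Fintype I]
    [Fintype J] [Fintype L] [DecidableEq I] [DecidableEq J] [DecidableEq L] (bI : ι → I) (bJ : κ → J)
    (bL : μ → L) where
  /-- the support of block labels -/
  S : Finset (I × J × L)
  hS : ∀ a b c, t a b c ≠ 0 → (bI a, bJ b, bL c) ∈ S
  /-- dimension of the tightness lattice -/
  r : ℕ
  /-- bound of the tightness coordinates -/
  b : ℕ
  α : I → Fin r → ℤ
  β : J → Fin r → ℤ
  γ : L → Fin r → ℤ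
  hα : Function.Injective α
  hβ : Function.Injective β
  hγ : Function.Injective γ
  hαb : ∀ i k, |α i k| ≤ (b : ℤ)
  hβb : ∀ j k, |β j k| ≤ (b : ℤ)
  htight : ∀ s ∈ S, ∀ k, α s.1 k + β s.2.1 k + γ s.2.2 k = 0
  /-- block values and formats -/
  v : I × J × L → ℝ
  fA : I × J × L → ℝ
  fB : I × J × L → ℝ
  fC : I × J × L → ℝ
  hv : ∀ s ∈ S, 0 < v s
  hfA : ∀ s ∈ S, 0 < fA s
  hfB : ∀ s ∈ S, 0 < fB s
  hfC : ∀ s ∈ S, 0 < fC s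
  hval : ∀ s ∈ S, HasFormatValue (partSubtensor bI bJ bL t {s.1} {s.2.1} {s.2.2}) (v s) (fA s)
    (fB s) (fC s)
  /-- counts, total and law -/
  c : I × J × L → ℕ
  hcS : ∀ s, s ∉ S → c s = 0
  d : ℕ
  hd : 0 < d
  hc : ∑ s, c s = d
  P : I × J × L → ℝ
  hP : ∀ s, P s = (c s : ℝ) / d
  /-- product form of the law on `S` -/
  f : I → ℝ
  g : J → ℝ
  h : L → ℝ
  hf : ∀ x ∈ S, 0 < f x.1
  hg : ∀ x ∈ S, 0 < g x.2.1
  hh : ∀ x ∈ S, 0 < h x.2.2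
  hprod : ∀ x ∈ S, P x = f x.1 * g x.2.1 * h x.2.2

namespace LaserPiece

section One

variable {K : Type u} [Field K]
variable {ι κ μ : Type} [Fintype ι] [Fintype κ] [Fintype μ] [DecidableEq ι] [DecidableEq κ]
  [DecidableEq μ]
variable {I J L : Type} [Fintype I] [Fintype J] [Fintype L] [DecidableEq I] [DecidableEq J]
  [DecidableEq L]
variable {t : ι → κ → μ → K} {bI : ι → I} {bJ : κ → J} {bL : μ → L}

/-- The first marginal entropy `H(P₁)` (bits) of the law. [cite: LeGall2014, Thm. 4.1] -/
def H₁ (D : LaserPiece K t bI bJ bL) : ℝ := shannonEntropy (marginalDist₁ D.P)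

/-- The second marginal entropy `H(P₂)`. [cite: LeGall2014, Thm. 4.1] -/
def H₂ (D : LaserPiece K t bI bJ bL) : ℝ := shannonEntropy (marginalDist₂ D.P)

/-- The third marginal entropy `H(P₃)`. [cite: LeGall2014, Thm. 4.1] -/
def H₃ (D : LaserPiece K t bI bJ bL) : ℝ := shannonEntropy (marginalDist₃ D.P)

/-- The weighted block value `Π_S v^P`. [cite: LeGall2012, §3] -/
def val (D : LaserPiece K t bI bJ bL) : ℝ := ∏ s ∈ D.S, D.v s ^ D.P s

/-- The weighted first format `Π_S fA^P`. [cite: LeGall2012, §3] -/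
def fmtA (D : LaserPiece K t bI bJ bL) : ℝ := ∏ s ∈ D.S, D.fA s ^ D.P s

/-- The weighted second format `Π_S fB^P`. [cite: LeGall2012, §3] -/
def fmtB (D : LaserPiece K t bI bJ bL) : ℝ := ∏ s ∈ D.S, D.fB s ^ D.P s

/-- The weighted third format `Π_S fC^P`. [cite: LeGall2012, §3] -/
def fmtC (D : LaserPiece K t bI bJ bL) : ℝ := ∏ s ∈ D.S, D.fC s ^ D.P s

/-- The law has mass one, over the label set and over the support. [cite: LeGall2014, §4] -/
theorem sum_P (D : LaserPiece K t bI bJ bL) : ∑ s, D.P s = 1 ∧ ∑ s ∈ D.S, D.P s = 1 :=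
  law_sum_eq_one' D.hcS D.hd D.hc D.hP

/-- The law is non-negative (a probability distribution on the support). [cite: LeGall2014, §4 (p. 8)] -/
theorem P_nonneg (D : LaserPiece K t bI bJ bL) (s : I × J × L) : 0 ≤ D.P s := by
  rw [D.hP]; positivity

/-- The law vanishes off the support. [cite: LeGall2014, §4 (p. 8)] -/
theorem P_eq_zero (D : LaserPiece K t bI bJ bL) (s : I × J × L) (hs : s ∉ D.S) : D.P s = 0 := by
  rw [D.hP, D.hcS s hs]; simp

/-- **`Γ_S(P) = 0`** for the product-form law of a laser piece. [cite: LeGall2014, §5 (p. 10)] -/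
theorem maxEntropyPenalty_eq_zero (D : LaserPiece K t bI bJ bL) : maxEntropyPenalty D.S D.P = 0 :=
  maxEntropyPenalty_eq_zero_of_mul D.S ⟨D.P_nonneg, D.sum_P.1⟩ D.P_eq_zero D.f D.g D.h D.hf D.hg
    D.hh D.hprod

/-- The weighted block value is positive. [cite: LeGall2012, §3] -/
theorem val_pos (D : LaserPiece K t bI bJ bL) : 0 < D.val :=
  Finset.prod_pos fun s hs => Real.rpow_pos_of_pos (D.hv s hs) _

/-- The weighted first format is positive. [cite: LeGall2012, §3] -/
theorem fmtA_pos (D : LaserPiece K t bI bJ bL) : 0 < D.fmtA :=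
  Finset.prod_pos fun s hs => Real.rpow_pos_of_pos (D.hfA s hs) _

/-- The weighted second format is positive. [cite: LeGall2012, §3] -/
theorem fmtB_pos (D : LaserPiece K t bI bJ bL) : 0 < D.fmtB :=
  Finset.prod_pos fun s hs => Real.rpow_pos_of_pos (D.hfB s hs) _

/-- The weighted third format is positive. [cite: LeGall2012, §3] -/
theorem fmtC_pos (D : LaserPiece K t bI bJ bL) : 0 < D.fmtC :=
  Finset.prod_pos fun s hs => Real.rpow_pos_of_pos (D.hfC s hs) _

/-- **The laser method in format currency for a laser piece** (Le Gall 2014 Thm 4.1 / Le Gall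
2012 §3 with `Γ = 0`): `t` is worth `2^{min(H₁,H₂,H₃)} · Π_S v^P` independent products of format
`(Π_S fA^P, Π_S fB^P, Π_S fC^P)`. [cite: LeGall2014, Thm. 4.1] [cite: LeGall2012, §3]
[cite: Coppersmith1997, §3] -/
theorem hasFormatValue (D : LaserPiece K t bI bJ bL) :
    HasFormatValue t ((2 : ℝ) ^ min D.H₁ (min D.H₂ D.H₃) * D.val) D.fmtA D.fmtB D.fmtC := by
  have key := laserMethod_hasFormatValue_of_counts t bI bJ bL D.S D.hS D.α D.β D.γ D.hα D.hβ D.hγ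
    D.hαb D.hβb D.htight D.v D.fA D.fB D.fC D.hv D.hfA D.hfB D.hfC D.hval D.c D.hcS D.hd D.hc
    D.P D.hP
  rw [D.maxEntropyPenalty_eq_zero, sub_zero] at key
  exact key

end One

section Pair

variable {K : Type u} [Field K]
variable {ι κ μ ι' κ' μ' : Type} [Fintype ι] [Fintype κ] [Fintype μ] [Fintype ι'] [Fintype κ']
  [Fintype μ'] [DecidableEq ι] [DecidableEq κ] [DecidableEq μ] [DecidableEq ι'] [DecidableEq κ']
  [DecidableEq μ']
variable {I J L I' J' L' : Type} [Fintype I] [Fintype J] [Fintype L] [Fintype I'] [Fintype J']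
  [Fintype L'] [DecidableEq I] [DecidableEq J] [DecidableEq L] [DecidableEq I'] [DecidableEq J']
  [DecidableEq L']
variable {t : ι → κ → μ → K} {bI : ι → I} {bJ : κ → J} {bL : μ → L}
variable {t' : ι' → κ' → μ' → K} {bI' : ι' → I'} {bJ' : κ' → J'} {bL' : μ' → L'}

/-- **Pooling: the laser data of `t ⊗ t'` with pair labels** — pair support, concatenated
tightness maps, Kronecker block values (`HasFormatValue.kronecker`), product counts over `d d'`,
the product law `P ⊗ P'`, again of product form. [cite: LeGall2014, §5 (p. 10)]
[cite: Coppersmith1997, §3] [cite: LeGall2012, §6.1] -/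
def pair (D : LaserPiece K t bI bJ bL) (D' : LaserPiece K t' bI' bJ' bL') :
    LaserPiece K (kroneckerTensor t t') (fun x : ι × ι' => (bI x.1, bI' x.2))
      (fun y : κ × κ' => (bJ y.1, bJ' y.2)) (fun z : μ × μ' => (bL z.1, bL' z.2)) where
  S := pairSupport D.S D'.S
  hS := pair_support_mem t bI bJ bL D.S D.hS t' bI' bJ' bL' D'.S D'.hS
  r := D.r + D'.r
  b := max D.b D'.b
  α := appendRows D.α D'.α
  β := appendRows D.β D'.β
  γ := appendRows D.γ D'.γ
  hα := appendRows_injective D.hα D'.hα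
  hβ := appendRows_injective D.hβ D'.hβ
  hγ := appendRows_injective D.hγ D'.hγ
  hαb := abs_appendRows_le D.hαb D'.hαb
  hβb := abs_appendRows_le D.hβb D'.hβb
  htight := appendRows_tight D.htight D'.htight
  v := pairVal D.v D'.v
  fA := pairVal D.fA D'.fA
  fB := pairVal D.fB D'.fB
  fC := pairVal D.fC D'.fC
  hv := pairVal_pos D.S D'.S D.hv D'.hv
  hfA := pairVal_pos D.S D'.S D.hfA D'.hfA
  hfB := pairVal_pos D.S D'.S D.hfB D'.hfB
  hfC := pairVal_pos D.S D'.S D.hfC D'.hfC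
  hval := hasFormatValue_pair_blocks t bI bJ bL D.S D.v D.fA D.fB D.fC D.hv D.hfA D.hfB D.hfC D.hval
    t' bI' bJ' bL' D'.S D'.v D'.fA D'.fB D'.fC D'.hv D'.hfA D'.hfB D'.hfC D'.hval
  c := fun s => D.c (pairFst s) * D'.c (pairSnd s)
  hcS := pairCount_eq_zero D.S D'.S D.hcS D'.hcS
  d := D.d * D'.d
  hd := Nat.mul_pos D.hd D'.hd
  hc := sum_pairCount D.hc D'.hc
  P := pairLaw D.P D'.P
  hP := pairLaw_eq_pairCount_div D.hP D'.hP
  f := fun i : I × I' => D.f i.1 * D'.f i.2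
  g := fun j : J × J' => D.g j.1 * D'.g j.2
  h := fun l : L × L' => D.h l.1 * D'.h l.2
  hf := pairFactor₁_pos D.S D'.S D.hf D'.hf
  hg := pairFactor₂_pos D.S D'.S D.hg D'.hg
  hh := pairFactor₃_pos D.S D'.S D.hh D'.hh
  hprod := pairLaw_productForm D.S D'.S D.f D.g D.h D.hprod D'.f D'.g D'.h D'.hprod

variable (D : LaserPiece K t bI bJ bL) (D' : LaserPiece K t' bI' bJ' bL')

/-- The support of the pair piece. [cite: LeGall2014, §5 (p. 10)] -/
theorem pair_S : (D.pair D').S = pairSupport D.S D'.S := rfl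

/-- The law of the pair piece. [cite: LeGall2014, §5 (p. 10)] -/
theorem pair_P : (D.pair D').P = pairLaw D.P D'.P := rfl

/-- **Pooled entropies add**: `H₁(P ⊗ P') = H₁(P) + H₁(P')`. [cite: LeGall2014, §5 (p. 10)]
[cite: Coppersmith1997, §3] -/
theorem pair_H₁ : (D.pair D').H₁ = D.H₁ + D'.H₁ :=
  (shannonEntropy_marginals_pairLaw D.sum_P.1 D'.sum_P.1).1

/-- `H₂(P ⊗ P') = H₂(P) + H₂(P')`. [cite: LeGall2014, §5 (p. 10)] [cite: Coppersmith1997, §3] -/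
theorem pair_H₂ : (D.pair D').H₂ = D.H₂ + D'.H₂ :=
  (shannonEntropy_marginals_pairLaw D.sum_P.1 D'.sum_P.1).2.1

/-- `H₃(P ⊗ P') = H₃(P) + H₃(P')`. [cite: LeGall2014, §5 (p. 10)] [cite: Coppersmith1997, §3] -/
theorem pair_H₃ : (D.pair D').H₃ = D.H₃ + D'.H₃ :=
  (shannonEntropy_marginals_pairLaw D.sum_P.1 D'.sum_P.1).2.2

/-- The weighted values multiply. [cite: LeGall2014, §5 (p. 10)] -/
theorem pair_val : (D.pair D').val = D.val * D'.val :=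
  prod_pairSupport_pairVal_rpow D.S D'.S D.v D'.v D.P D'.P D.hv D'.hv D.sum_P.2 D'.sum_P.2

/-- The weighted first formats multiply. [cite: LeGall2014, §5 (p. 10)] -/
theorem pair_fmtA : (D.pair D').fmtA = D.fmtA * D'.fmtA :=
  prod_pairSupport_pairVal_rpow D.S D'.S D.fA D'.fA D.P D'.P D.hfA D'.hfA D.sum_P.2 D'.sum_P.2

/-- The weighted second formats multiply. [cite: LeGall2014, §5 (p. 10)] -/
theorem pair_fmtB : (D.pair D').fmtB = D.fmtB * D'.fmtB :=
  prod_pairSupport_pairVal_rpow D.S D'.S D.fB D'.fB D.P D'.P D.hfB D'.hfB D.sum_P.2 D'.sum_P.2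

/-- The weighted third formats multiply. [cite: LeGall2014, §5 (p. 10)] -/
theorem pair_fmtC : (D.pair D').fmtC = D.fmtC * D'.fmtC :=
  prod_pairSupport_pairVal_rpow D.S D'.S D.fC D'.fC D.P D'.P D.hfC D'.hfC D.sum_P.2 D'.sum_P.2

/-- **The pooled value of `t ⊗ t'`** (`= laserMethod_hasFormatValue_pair_of_mul`, read off the
pair piece): `2^{min_m (H_m + H'_m)} · val · val'` products of format `(fmtA·fmtA', …)`.
[cite: Coppersmith1997, §3] [cite: LeGall2014, Thm. 4.1 and §5] [cite: LeGall2012, §6.1] -/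
theorem hasFormatValue_pair :
    HasFormatValue (kroneckerTensor t t')
      ((2 : ℝ) ^ min (D.H₁ + D'.H₁) (min (D.H₂ + D'.H₂) (D.H₃ + D'.H₃)) * (D.val * D'.val))
      (D.fmtA * D'.fmtA) (D.fmtB * D'.fmtB) (D.fmtC * D'.fmtC) := by
  have key := (D.pair D').hasFormatValue
  rwa [pair_H₁, pair_H₂, pair_H₃, pair_val, pair_fmtA, pair_fmtB, pair_fmtC] at key

end Pair

end LaserPiece

end Literature.Computability.AlgebraicComplexity

end
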